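import Mathlib.Algebra.BigOperators.Finprod
import Literature.IUT.HodgeArakelov.KummerPrimeStrips

/-!
# [IUTchII] Def 4.9 (viii): the global realified Frobenioid and the `F^{⊩▶×μ}`-prime-strip WITHOUT a
# `Fintype` hypothesis on the index of places (Fintype-free successor; RULING D13 / bridge debt B11)

Owner successor file (abc-iut cell, layer L6; abc-iut-L6-t2). `KummerPrimeStrips.lean` (p405008, FROZEN) types
the global realified Frobenioid `*C^⊩` of an `F^{⊩▶×μ}`-prime-strip ([IUTchII] Def 4.9 (viii) p. 158; [IUTchI]
Def 5.2 (iv); [FrdI] Ex 6.3 / Thm 6.4) as `RealifiedGlobalFrobenioid (V) [Fintype V]` with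
`deg_eq_sum : deg a = ∑ v, localDeg a v`, and the strip `FVdashTriMuPrimeStrip` / `FVdashTriMuIso` over
`[Fintype V]`. The index of places in print is `V̲ ⥲ V_mod` ([IUTchI] Def 3.1 (e)), the set of ALL valuations
of `F_mod` — INFINITE (`Literature.IUT.HodgeTheaters.InitialThetaData.isEmpty_fintype_V`, p408766), so no
`[Fintype V̲]` instance exists at the real index (L5-t2's C9-d obstruction; L6/L5 RULING D13: truncated
bridges of record + a Fintype-free successor as debt B11). What print actually uses is that an arithmetic
degree is a sum of local contributions of which only FINITELY MANY are nonzero ([FrdI] Ex 6.3: arithmetic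
divisors are finitely supported).

This file gives the Fintype-free successors, with the SAME field names where unchanged:

* `RealifiedGlobalFrobenioidF V` — `localDeg a` finitely supported (`localDeg_finite`),
  `deg_eq_finsum : deg a = ∑ᶠ v, localDeg a v`, and `Iso` an EQUIVALENCE RELATION (`iso_equivalence`; the frozen
  record omitted it, which blocks composing/inverting strip isomorphisms — the `.toF` bridges take it as a hypothesis);
* `FVdashTriMuPrimeStripF P G X` — the `F^{⊩▶×μ}`-prime-strip record over it (same local data, `rho`,
  generators at bad places, pilot object with its local degrees), with **`pilot_deg_neg` PROVED again**
  (Def 4.9 (viii) "of negative «arithmetic degree»") via the finite support;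
* `FVdashTriMuIsoF` and `pilot_deg_eq`;
* the bridges from the frozen `[Fintype V]` versions: `RealifiedGlobalFrobenioid.toF`,
  `FVdashTriMuPrimeStrip.toF` (finsum = sum on a finite type), so nothing typed over the old records is lost.

S. Mochizuki, *Inter-universal Teichmüller theory II*, kurims Dec-2020 manuscript, Def 4.9 (viii) p. 158;
*I*, Def 3.1 (e) p. 62, Def 5.2 (iv); *The geometry of Frobenioids I*, Ex 6.3. Claim key `Mochizuki2012`
DISPUTED (D-0012): definitions and an elementary sign argument; nothing here asserts a disputed claim.
-/

namespace Literature.IUT.HodgeArakelov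

open scoped NNReal

universe u v w

/-! ### 1. The global realified Frobenioid with finitely supported local degrees -/

/-- INTERFACE (Fintype-free successor of `RealifiedGlobalFrobenioid`): the global realified Frobenioid
`*C^⊩` of an `F^{⊩}`- or `F^{⊩▶×μ}`-prime-strip ([IUTchII] Def 4.9 (viii) p. 158; [IUTchI] Def 5.2 (iv); [FrdI]
Ex 6.3, Thm 6.4): objects, isomorphism relation, arithmetic degree, and its local components at the primes
`Prime(*C^⊩) ⥲ V` — finitely many nonzero for each object, the degree being their (finite) sum.
[cite: Mochizuki2012, Def 4.9 (viii) p.158] -/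
structure RealifiedGlobalFrobenioidF (V : Type u) where
  /-- objects of `*C^⊩` -/
  Obj : Type v
  /-- isomorphism of objects -/
  Iso : Obj → Obj → Prop
  /-- being isomorphic is an equivalence relation (objects of a category; needed to compose/invert
  isomorphisms of prime-strips — the frozen record omitted it) -/
  iso_equivalence : Equivalence Iso
  /-- the arithmetic degree of an object ([FrdI] Thm 6.4 (i),(ii)) -/
  deg : Obj → ℝ
  /-- isomorphic objects have equal degree -/
  deg_iso : ∀ a b, Iso a b → deg a = deg b
  /-- `Prime(*C^⊩) ⥲ V`: the local components of the degree -/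
  localDeg : Obj → V → ℝ
  /-- only finitely many local components are nonzero ([FrdI] Ex 6.3: arithmetic divisors are finitely
  supported) -/
  localDeg_finite : ∀ a, (Function.support (localDeg a)).Finite
  /-- the degree is the (finite) sum of the local contributions -/
  deg_eq_finsum : ∀ a, deg a = ∑ᶠ v, localDeg a v

/-- The frozen `[Fintype V]` record, once its isomorphism relation is known to be an equivalence relation (the
frozen record does not carry this), IS a Fintype-free one (on a finite index every function is finitely supported
and `∑ᶠ = ∑`). [cite: Mochizuki2012, Def 4.9 (viii) p.158] -/
def RealifiedGlobalFrobenioid.toF {V : Type u} [Fintype V] (C : RealifiedGlobalFrobenioid.{u, v} V)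
    (hC : Equivalence C.Iso) : RealifiedGlobalFrobenioidF.{u, v} V where
  Obj := C.Obj
  Iso := C.Iso
  iso_equivalence := hC
  deg := C.deg
  deg_iso := C.deg_iso
  localDeg := C.localDeg
  localDeg_finite a := Set.toFinite _
  deg_eq_finsum a := by rw [C.deg_eq_sum a, finsum_eq_sum_of_fintype]

/-- The bridge keeps degrees. [cite: Mochizuki2012, Def 4.9 (viii) p.158] -/
@[simp] theorem RealifiedGlobalFrobenioid.toF_deg {V : Type u} [Fintype V]
    (C : RealifiedGlobalFrobenioid.{u, v} V) (hC : Equivalence C.Iso) (a : C.Obj) : (C.toF hC).deg a = C.deg a :=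
  rfl

/-- The bridge keeps local degrees. [cite: Mochizuki2012, Def 4.9 (viii) p.158] -/
@[simp] theorem RealifiedGlobalFrobenioid.toF_localDeg {V : Type u} [Fintype V]
    (C : RealifiedGlobalFrobenioid.{u, v} V) (hC : Equivalence C.Iso) (a : C.Obj) (v : V) :
    (C.toF hC).localDeg a v = C.localDeg a v := rfl

/-! ### 2. The `F^{⊩▶×μ}`-prime-strip and its pilot object, Fintype-free -/

/-- An **`F^{⊩▶×μ}`-prime-strip** ([IUTchII] Def 4.9 (viii) p. 158), Fintype-free successor of
`FVdashTriMuPrimeStrip` (same fields; `realified` is now a `RealifiedGlobalFrobenioidF`): "a collection of data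
`*F^{⊩▶×μ} = (*C^⊩, Prime(*C^⊩) ⥲ V, *F^{⊢▶×μ}, {*ρ_v}_{v ∈ V})`", with its pilot object "determined by the
generators of the monoids «`O^▶(−)`» … at `v ∈ V^bad`, … of negative «arithmetic degree»" — local degrees of
the pilot ARE `−ρ_v(generator)` at bad `v` and `0` elsewhere. [cite: Mochizuki2012, Def 4.9 (viii) p.158] -/
structure FVdashTriMuPrimeStripF {V : Type u} (P : PlaceData V) (G : V → Type u)
    [∀ v, Group (G v)] (X : ∀ v, GroupTheoreticUnits.{u, w} (G v)) where
  /-- `*C^⊩` with `Prime(*C^⊩) ⥲ V` (field renamed `realifiedF` in the successor to keep the frozen record's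
  lemma names distinct) -/
  realifiedF : RealifiedGlobalFrobenioidF.{u, v} V
  /-- `*F^{⊢▶×μ}` -/
  strip : FTriMuPrimeStrip.{u, v, w} P G X
  /-- `{*ρ_v}_{v ∈ V}` read on `O^▶(−)_v`: a monoid homomorphism into `(ℝ_{≥0}, +)` -/
  rho : ∀ v : V, OTri ((strip.localDatum v).O) →* Multiplicative NNReal
  /-- the generator of `O^▶(−)_v ≅ ℕ` at a bad place -/
  triGen : ∀ v : V, P.kind v = PlaceKind.bad → OTri ((strip.localDatum v).O)
  /-- the generator has positive `rho` -/
  rho_triGen_pos : ∀ (v : V) (h : P.kind v = PlaceKind.bad), 0 < Multiplicative.toAdd (rho v (triGen v h))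
  /-- the pilot object (well-defined up to isomorphism) -/
  pilot : realifiedF.Obj
  /-- its local degree at a bad place is `−ρ_v(generator of O^▶)` … -/
  pilot_localDeg_bad : ∀ (v : V) (h : P.kind v = PlaceKind.bad),
    realifiedF.localDeg pilot v = -((Multiplicative.toAdd (rho v (triGen v h)) : NNReal) : ℝ)
  /-- … and `0` at the other places -/
  pilot_localDeg_other : ∀ v : V, P.kind v ≠ PlaceKind.bad → realifiedF.localDeg pilot v = 0

namespace FVdashTriMuPrimeStripF

variable {V : Type u} {P : PlaceData V} {G : V → Type u} [∀ v, Group (G v)]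
  {X : ∀ v, GroupTheoreticUnits.{u, w} (G v)} (S : FVdashTriMuPrimeStripF.{u, v, w} P G X)

/-- The pilot object's local degree is nonpositive everywhere. [cite: Mochizuki2012, Def 4.9 (viii) p.158] -/
theorem pilot_localDeg_nonpos (v : V) : S.realifiedF.localDeg S.pilot v ≤ 0 := by
  by_cases h : P.kind v = PlaceKind.bad
  · rw [S.pilot_localDeg_bad v h]; exact neg_nonpos.mpr (NNReal.coe_nonneg _)
  · rw [S.pilot_localDeg_other v h]

/-- At a bad place the pilot object's local degree is negative. [cite: Mochizuki2012, Def 4.9 (viii) p.158] -/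
theorem pilot_localDeg_neg (v : V) (h : P.kind v = PlaceKind.bad) : S.realifiedF.localDeg S.pilot v < 0 := by
  rw [S.pilot_localDeg_bad v h]
  have h0 : (0 : ℝ) < ((Multiplicative.toAdd (S.rho v (S.triGen v h)) : NNReal) : ℝ) :=
    NNReal.coe_pos.mpr (S.rho_triGen_pos v h)
  linarith

/-- In particular (for the record) the finitely many places where the pilot object has nonzero local degree
are all bad. [cite: Mochizuki2012, Def 4.9 (viii) p.158] -/
theorem support_pilot_localDeg_subset :
    Function.support (S.realifiedF.localDeg S.pilot) ⊆ {v | P.kind v = PlaceKind.bad} := by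
  intro v hv
  by_contra h
  exact hv (S.pilot_localDeg_other v h)

/-- **Def 4.9 (viii) p. 158: the pilot object is "of negative «arithmetic degree»"** — PROVED, Fintype-free:
the degree is the finite sum of its nonzero local degrees, each `≤ 0`, the one at a bad place `v₀`
(`V^bad ≠ ∅`) being `< 0`. [cite: Mochizuki2012, Def 4.9 (viii) p.158] -/
theorem pilot_deg_neg : S.realifiedF.deg S.pilot < 0 := by
  classical
  obtain ⟨v₀, hv₀⟩ := P.bad_nonempty
  have hfin := S.realifiedF.localDeg_finite S.pilot
  rw [S.realifiedF.deg_eq_finsum, finsum_eq_sum _ hfin]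
  have hlt : S.realifiedF.localDeg S.pilot v₀ < 0 := S.pilot_localDeg_neg v₀ hv₀
  have hmem : v₀ ∈ hfin.toFinset := by
    rw [Set.Finite.mem_toFinset, Function.mem_support]
    exact hlt.ne
  calc ∑ v ∈ hfin.toFinset, S.realifiedF.localDeg S.pilot v
      < ∑ v ∈ hfin.toFinset, (0 : ℝ) :=
        Finset.sum_lt_sum (fun v _ => S.pilot_localDeg_nonpos v) ⟨v₀, hmem, hlt⟩
    _ = 0 := by simp

end FVdashTriMuPrimeStripF

/-- The frozen `[Fintype V]` strip IS a Fintype-free one (same data; realified Frobenioid via `toF`).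
[cite: Mochizuki2012, Def 4.9 (viii) p.158] -/
def FVdashTriMuPrimeStrip.toF {V : Type u} [Fintype V] {P : PlaceData V} {G : V → Type u}
    [∀ v, Group (G v)] {X : ∀ v, GroupTheoreticUnits.{u, w} (G v)}
    (S : FVdashTriMuPrimeStrip.{u, v, w} P G X) (hS : Equivalence S.realified.Iso) :
    FVdashTriMuPrimeStripF.{u, v, w} P G X where
  realifiedF := S.realified.toF hS
  strip := S.strip
  rho := S.rho
  triGen := S.triGen
  rho_triGen_pos := S.rho_triGen_pos
  pilot := S.pilot
  pilot_localDeg_bad := S.pilot_localDeg_bad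
  pilot_localDeg_other := S.pilot_localDeg_other

/-- The bridge keeps the pilot object's degree. [cite: Mochizuki2012, Def 4.9 (viii) p.158] -/
theorem FVdashTriMuPrimeStrip.toF_pilot_deg {V : Type u} [Fintype V] {P : PlaceData V} {G : V → Type u}
    [∀ v, Group (G v)] {X : ∀ v, GroupTheoreticUnits.{u, w} (G v)}
    (S : FVdashTriMuPrimeStrip.{u, v, w} P G X) (hS : Equivalence S.realified.Iso) :
    (S.toF hS).realifiedF.deg (S.toF hS).pilot = S.realified.deg S.pilot := rfl

/-! ### 3. Isomorphisms of `F^{⊩▶×μ}`-prime-strips, Fintype-free -/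

/-- An **isomorphism of `F^{⊩▶×μ}`-prime-strips** ([IUTchII] Def 4.9 (viii) p. 158), Fintype-free successor of
`FVdashTriMuIso` (same fields). [cite: Mochizuki2012, Def 4.9 (viii) p.158] -/
structure FVdashTriMuIsoF {V : Type u} {P : PlaceData V} {G : V → Type u} [∀ v, Group (G v)]
    {X : ∀ v, GroupTheoreticUnits.{u, w} (G v)}
    (LocalIso : ∀ v, LocalTriMuDatum.{u, v, w} P.ell (G v) (X v) (P.kind v) →
      LocalTriMuDatum.{u, v, w} P.ell (G v) (X v) (P.kind v) → Prop)
    (S T : FVdashTriMuPrimeStripF.{u, v, w} P G X) where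
  /-- bijection on objects of `*C^⊩` -/
  objEquiv : S.realifiedF.Obj ≃ T.realifiedF.Obj
  /-- it respects isomorphism classes -/
  map_iso : ∀ a b, S.realifiedF.Iso a b ↔ T.realifiedF.Iso (objEquiv a) (objEquiv b)
  /-- it preserves arithmetic degrees -/
  deg_eq : ∀ a, T.realifiedF.deg (objEquiv a) = S.realifiedF.deg a
  /-- pilot object goes to pilot object, up to isomorphism -/
  map_pilot : T.realifiedF.Iso (objEquiv S.pilot) T.pilot
  /-- the local data are identified place by place -/
  localIso : ∀ v, LocalIso v (S.strip.localDatum v) (T.strip.localDatum v)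

/-- An isomorphism of `F^{⊩▶×μ}`-prime-strips identifies the (negative) degrees of the pilot objects.
[cite: Mochizuki2012, Def 4.9 (viii) p.158] -/
theorem FVdashTriMuIsoF.pilot_deg_eq {V : Type u} {P : PlaceData V} {G : V → Type u}
    [∀ v, Group (G v)] {X : ∀ v, GroupTheoreticUnits.{u, w} (G v)}
    {LocalIso : ∀ v, LocalTriMuDatum.{u, v, w} P.ell (G v) (X v) (P.kind v) →
      LocalTriMuDatum.{u, v, w} P.ell (G v) (X v) (P.kind v) → Prop}
    {S T : FVdashTriMuPrimeStripF.{u, v, w} P G X} (e : FVdashTriMuIsoF LocalIso S T) :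
    S.realifiedF.deg S.pilot = T.realifiedF.deg T.pilot := by
  rw [← e.deg_eq S.pilot]
  exact T.realifiedF.deg_iso _ _ e.map_pilot

/-- A frozen `[Fintype V]` isomorphism of strips gives one between the Fintype-free strips.
[cite: Mochizuki2012, Def 4.9 (viii) p.158] -/
def FVdashTriMuIso.toF {V : Type u} [Fintype V] {P : PlaceData V} {G : V → Type u} [∀ v, Group (G v)]
    {X : ∀ v, GroupTheoreticUnits.{u, w} (G v)}
    {LocalIso : ∀ v, LocalTriMuDatum.{u, v, w} P.ell (G v) (X v) (P.kind v) →
      LocalTriMuDatum.{u, v, w} P.ell (G v) (X v) (P.kind v) → Prop}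
    {S T : FVdashTriMuPrimeStrip.{u, v, w} P G X} (hS : Equivalence S.realified.Iso)
    (hT : Equivalence T.realified.Iso) (e : FVdashTriMuIso LocalIso S T) :
    FVdashTriMuIsoF LocalIso (S.toF hS) (T.toF hT) where
  objEquiv := e.objEquiv
  map_iso := e.map_iso
  deg_eq := e.deg_eq
  map_pilot := e.map_pilot
  localIso := e.localIso

end Literature.IUT.HodgeArakelov
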